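import Summits.ResolutionOfSingularities.ResolutionOfSingularities.Theses.WildCones
import Summits.ResolutionOfSingularities.ResolutionOfSingularities.Theorems.NoPeriodicIsolatedAtom.Negative.FalseWithoutIsol

/-!
# `ClassicalRegimes` (crux stmt-ResolutionOfSingularities-16884, route `WildCones`):
# the multiplicity conjunct `MultP` and the primality binder are load-bearing
# (negative-side support from the crux-disprover seat; this file does NOT refute the crux)

Companion of `FalseWithoutIsol.lean` (same directory; see there for the crux and for the exactness
certificate `crux_iff : ClassicalRegimes ↔ … := Iff.rfl` over the mirrored operators `clean`, `bl`,
`ord`, `dv`, `tr`, `step`, `run`, `ser`, `pd`, `jac` of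
`Theorems/NoPeriodicIsolatedAtom/Negative/FalseWithoutIsol.lean`).

ONE witness serves both lemmas of this file: the SMOOTH branch `z^p + u` in one variable
(`n = 1`, state `lineGerm`: coefficient `1` on the exponent `(1)`). Its Jacobian ideal is `(1)`, so it
is `Isol` at every `p`; and for every `p ≠ 1` it is a literal FIXED POINT of every step of the
dynamics, because the division exponent `ite (p ≤ ord (clean c)) p 0` is `0` — for a prime `p` since
the cleaned order `1` is `< p`, for `p = 0` because both branches are `0` — and in one variable the
blow-up chart and the translation are identities (`bl_one`, `tr_one`).

* `classicalRegimes_false_without_MultP` — delete the conjunct `MultP` from the run predicate: false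
  at `(p, n, κ) = (2, 1, 𝔽₂)` (an eternal isolated run of multiplicity ONE: once `MultP` fails the
  typed dynamics stops dividing by `u_i^p` and becomes the total transform, which fixes `u`). The
  crux's only exit mechanism in the regime `n = 1` ("the cleaned order drops by `p` per step until it
  is `< p`") is exactly the failure of `MultP`; any proof must use it.
* `classicalRegimes_false_without_Prime` — delete the binder `p.Prime`: false at the junk value
  `p = 0` (`κ = ℚ`, `CharP ℚ 0`, perfect), where cleaning deletes only the constant term, `MultP`'s
  order clause `0 ≤ |A|` is vacuous and no division ever happens: `z^0 + u` runs for ever, isolated of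
  "multiplicity `0`". Primality enters the crux at least through `p ≠ 0` (the refuter notes on the
  item record that `p ≠ 0, 1` is all the three regimes use of it).

Not load-bearing, for the record (positive facts, recorded on the item by earlier refuter seats, not
restated here): the binder `0 < n` (at `n = 0` the statement holds vacuously — `clean ≡ 0` kills
`MultP` at stage `0`) and `[PerfectField κ]` (a run over `κ` is verbatim a run over any perfect
extension, with `Isol`/`MultP` unchanged).
-/

noncomputable section

set_option linter.dupNamespace false

namespace Summit.ResolutionOfSingularities.ResolutionOfSingularities.Theorems.ClassicalRegimes.Negative

open Summit.ResolutionOfSingularities.ResolutionOfSingularities.Theses.WildCones (ClassicalRegimes)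
open Summit.ResolutionOfSingularities.ResolutionOfSingularities.Theorems.NoPeriodicIsolatedAtom.Negative
  (clean bl ord dv tr step run ser pd jac)
open scoped BigOperators Classical

/-! ## The smooth branch `z^p + u` (`n = 1`) is a fixed point of the dynamics whenever `p ≠ 1` -/

/-- The smooth-branch state `a(u) = u` in one variable: coefficient `1` on the exponent `(1)`, `0`
elsewhere. [folklore] -/
def lineGerm (κ : Type) [Field κ] : (Fin 1 → ℕ) → κ := fun A => if A = ![1] then 1 else 0

variable {κ : Type} [Field κ]

/-- `lineGerm` is supported exactly on the exponent `(1)`. [folklore] -/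
lemma lineGerm_ne_zero_iff (A : Fin 1 → ℕ) : lineGerm κ A ≠ 0 ↔ A = ![1] := by
  unfold lineGerm
  by_cases h : A = ![1] <;> simp [h]

/-- `u` is `p`-clean for every `p ≠ 1` (the exponent `1` is not divisible by `p`). [folklore] -/
lemma clean_lineGerm {p : ℕ} (hp : p ≠ 1) : clean p (lineGerm κ) = lineGerm κ := by
  funext A
  unfold clean
  by_cases h : ∀ j, p ∣ A j
  · rw [if_pos h]
    by_cases hA : A = ![1]
    · exact absurd (Nat.dvd_one.mp (by simpa [hA] using h 0)) hp
    · simp [lineGerm, hA]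
  · rw [if_neg h]

/-- The order of `u` is `1`. [folklore] -/
lemma ord_lineGerm : ord (lineGerm κ) = 1 := by
  unfold ord
  have hset : {m : ℕ | ∃ A, lineGerm κ A ≠ 0 ∧ m = Finset.sum Finset.univ (fun j => A j)} = {1} := by
    ext m
    simp only [Set.mem_setOf_eq, Set.mem_singleton_iff, lineGerm_ne_zero_iff]
    constructor
    · rintro ⟨A, rfl, rfl⟩
      simp
    · rintro rfl
      exact ⟨![1], rfl, by simp⟩
  rw [hset, csInf_singleton]

/-- In one variable the (only) blow-up chart is the identity on coefficient functions. [folklore] -/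
lemma bl_one (c : (Fin 1 → ℕ) → κ) : bl 0 c = c := by
  funext B
  unfold bl
  have h0 : Finset.univ.erase (0 : Fin 1) = ∅ := by decide
  simp only [h0, Finset.sum_empty, zero_le, if_true, Nat.sub_zero, Function.update_eq_self]

/-- Dividing by `u_i^0` is the identity. [folklore] -/
lemma dv_zero' {n : ℕ} (i : Fin n) (c : (Fin n → ℕ) → κ) : dv i 0 c = c := by
  funext B
  unfold dv
  simp

/-- In one variable the translation step is the identity (there is no second variable to translate;
only `D = 0` contributes to the sum). [folklore] -/
lemma tr_one (τ : Fin 1 → κ) (s : ℕ) (c : (Fin 1 → ℕ) → κ) : tr 0 τ s c = c := by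
  funext B
  unfold tr
  rw [Finset.sum_eq_single (0 : Fin 1 → ℕ)]
  · simp
  · intro D _ hD
    have : D 0 ≠ 0 := by
      intro h0; apply hD; funext j; fin_cases j; exact h0
    rw [if_neg this]
  · intro h
    exact absurd (by simp [Fintype.mem_piFinset]) h

/-- For `p ≠ 1` the division exponent `ite (p ≤ 1) p 0` at cleaned order `1` is `0`: at `p = 0` both
branches are `0`, at `p ≥ 2` the test `p ≤ 1` fails. [folklore] -/
lemma div_exponent_eq_zero {p : ℕ} (hp : p ≠ 1) : (@ite ℕ (p ≤ 1) (Classical.dec _) p 0) = 0 := by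
  by_cases h : p ≤ 1
  · rw [if_pos h]; omega
  · rw [if_neg h]

/-- **Fixed point**: for `p ≠ 1`, one step of the dynamics (the chart is forced, the translation is
arbitrary) maps `u` to itself — no division happens. [folklore] -/
lemma step_lineGerm {p : ℕ} (hp : p ≠ 1) (i : Fin 1) (τ : Fin 1 → κ) :
    step p i τ (lineGerm κ) = lineGerm κ := by
  have hi : i = 0 := Subsingleton.elim _ _
  subst hi
  unfold step
  rw [clean_lineGerm hp, ord_lineGerm, div_exponent_eq_zero hp, bl_one, dv_zero', tr_one,
    clean_lineGerm hp]

/-- Hence every run from `u` is constant (`p ≠ 1`). [folklore] -/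
lemma run_lineGerm {p : ℕ} (hp : p ≠ 1) (i : ℕ → Fin 1) (t : ℕ → Fin 1 → κ) (m : ℕ) :
    run p (lineGerm κ) i t m = lineGerm κ := by
  induction m with
  | zero => rfl
  | succ m ih =>
    show step p (i m) (t m) (run p (lineGerm κ) i t m) = lineGerm κ
    rw [ih, step_lineGerm hp]

/-- `∂u/∂u = 1` as a formal power series (`p ≠ 1`, so `u` survives cleaning). [folklore] -/
lemma pd_ser_lineGerm {p : ℕ} (hp : p ≠ 1) : pd 0 (ser p (lineGerm κ)) = 1 := by
  ext A
  rw [MvPowerSeries.coeff_one]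
  change ((A 0 + 1 : ℕ) : κ) * clean p (lineGerm κ) (⇑((A + Finsupp.single (0 : Fin 1) 1 : Fin 1 →₀ ℕ))) = _
  rw [clean_lineGerm hp]
  unfold lineGerm
  have key : ((⇑((A + Finsupp.single (0 : Fin 1) 1 : Fin 1 →₀ ℕ))) = ![1]) ↔ A = 0 := by
    constructor
    · intro h
      have h0 := congrFun h 0
      simp at h0
      ext
      simpa [Fin.default_eq_zero] using h0
    · rintro rfl
      funext j
      have hj : j = 0 := Subsingleton.elim _ _
      subst hj
      simp
  by_cases hA : A = 0
  · rw [if_pos (key.mpr hA), if_pos hA]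
    subst hA
    simp
  · rw [if_neg (fun h => hA (key.mp h)), if_neg hA, mul_zero]

/-- The Jacobian ideal of `u` is the unit ideal. [folklore] -/
lemma jac_lineGerm {p : ℕ} (hp : p ≠ 1) : jac p (lineGerm κ) = ⊤ := by
  unfold jac
  rw [Ideal.eq_top_iff_one]
  exact Ideal.subset_span ⟨0, pd_ser_lineGerm hp⟩

/-- `u` is ISOLATED: `κ[[u]]/(1) = 0` is finite over `κ`. [folklore] -/
lemma isol_lineGerm {p : ℕ} (hp : p ≠ 1) :
    Module.Finite κ (MvPowerSeries (Fin 1) κ ⧸ jac p (lineGerm κ)) := by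
  rw [jac_lineGerm hp]
  haveI : Subsingleton (MvPowerSeries (Fin 1) κ ⧸ (⊤ : Ideal (MvPowerSeries (Fin 1) κ))) :=
    Ideal.Quotient.subsingleton_iff.mpr rfl
  exact Module.Finite.of_finite

/-! ## The two load-bearing lemmas -/

/-- **`MultP` is load-bearing in `ClassicalRegimes`.** The proposition below is the right-hand side
of `crux_iff` (`FalseWithoutIsol.lean`) with the multiplicity conjunct
`(∃ A, clean … A ≠ 0) ∧ ∀ A, clean … A ≠ 0 → p ≤ |A|` deleted and nothing else changed; it is false at
`(p, n, κ) = (2, 1, 𝔽₂)`: the smooth branch `z² + u` is isolated and, its cleaned order `1` being `< 2`,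
is never divided — an eternal isolated run. Any proof of the crux must use `MultP` (in the regime
`n = 1` the whole content of the crux is that `MultP` fails after `⌊ord/p⌋` steps). [folklore] -/
theorem classicalRegimes_false_without_MultP :
    ¬ ∀ p : ℕ, p.Prime → ∀ n : ℕ, 0 < n → (n ≤ 2 ∨ p = 2) → ∀ (κ : Type) [Field κ] [CharP κ p] [PerfectField κ]
        (c₀ : (Fin n → ℕ) → κ) (i : ℕ → Fin n) (t : ℕ → Fin n → κ),
        ¬ (∀ m, Module.Finite κ (MvPowerSeries (Fin n) κ ⧸ jac p (run p c₀ i t m))) := by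
  intro h
  haveI : PerfectField (ZMod 2) := PerfectField.ofFinite
  exact h 2 Nat.prime_two 1 one_pos (Or.inl (by norm_num)) (ZMod 2) (lineGerm (ZMod 2)) (fun _ => 0) (fun _ _ => 0)
    (fun m => by rw [run_lineGerm (by norm_num)]; exact isol_lineGerm (by norm_num))

/-- **The binder `p.Prime` is load-bearing in `ClassicalRegimes` (junk value `p = 0`).** The
proposition below is the right-hand side of `crux_iff` (`FalseWithoutIsol.lean`) with `p.Prime →`
deleted and nothing else changed; it is false at `(p, n, κ) = (0, 1, ℚ)` (`CharP ℚ 0`, `ℚ` perfect,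
regime `n ≤ 2`): with `p = 0` the division exponent is `0` in both branches, `0`-cleaning keeps `u`,
`MultP`'s order clause is `0 ≤ |A|`, and `z^0 + u` is an eternal isolated run "of multiplicity `0`".
So primality is used at least through `p ≠ 0`. [folklore] -/
theorem classicalRegimes_false_without_Prime :
    ¬ ∀ p : ℕ, ∀ n : ℕ, 0 < n → (n ≤ 2 ∨ p = 2) → ∀ (κ : Type) [Field κ] [CharP κ p] [PerfectField κ]
        (c₀ : (Fin n → ℕ) → κ) (i : ℕ → Fin n) (t : ℕ → Fin n → κ),
        ¬ (∀ m, Module.Finite κ (MvPowerSeries (Fin n) κ ⧸ jac p (run p c₀ i t m)) ∧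
          ((∃ A, clean p (run p c₀ i t m) A ≠ 0) ∧
            ∀ A, clean p (run p c₀ i t m) A ≠ 0 → p ≤ Finset.sum Finset.univ (fun j => A j))) := by
  intro h
  haveI : CharP ℚ 0 := CharP.ofCharZero ℚ
  refine h 0 1 one_pos (Or.inl (by norm_num)) ℚ (lineGerm ℚ) (fun _ => 0) (fun _ _ => 0) (fun m => ?_)
  rw [run_lineGerm (by norm_num)]
  refine ⟨isol_lineGerm (by norm_num), ?_, fun A _ => Nat.zero_le _⟩
  rw [clean_lineGerm (by norm_num)]
  exact ⟨![1], by simp [lineGerm]⟩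

end Summit.ResolutionOfSingularities.ResolutionOfSingularities.Theorems.ClassicalRegimes.Negative

end
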